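import Summits.Ventures.PercRepro.S3MaxFlatGlue
import Summits.Ventures.PercRepro.S3LPPhi
import Summits.Ventures.PercRepro.TheoremNAll
import Summits.Ventures.PercRepro.RankLevelSetLevelSixRowsNineToFifteen

/-!
# PercRepro — THE LEVEL-7 ROW `p = 10` WITH A MAXIMAL RANK-`8` FLAT REDUCES TO C-025 AT `(8, 6)` ON THE FLAT (p7 g23; an S4 feeder
on p7 g22's S3MaxFlatKit / S3MaxFlatGlue)

Let `M` be a coloop-free matroid of rank `10` and `F ⊆ E` a rank-`8` set with `|E ∖ F| = 3` (the coloop-free maximum for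
rank `8`). By the rank additivity of S3MaxFlatKit, `ρ(A ∪ T) = ρ(A) + |T|` for `A ⊆ F` and `T ⊊ X = E ∖ F`. Writing every
`S ⊆ E` as `A ⊔ T` (`A = S ∩ F`, `T = S ∩ X`):
* a `U(10, 7)`-set has `|T| = 2` and `A ∈ U(8, 6)` of `M ↾ F` (three `T` per `A`), or `T = X` and `ρ(F ∖ A) = 7` with
  `ρ(A) ∈ {7, 8}`;
* the sets `A ∪ T` with `(ρ(A), |T|) ∈ {(8, 0), (7, 1), (8, 1), (7, 2)}` are distinct `Y(10, 7)`-sets.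
With `Φ(10, 7) = 5/2` and C-025 at `(8, 6)` on `M ↾ F` (`Φ(8, 6) = 8/7`), `5/2 · #U(10, 7) ≤ #Y(10, 7)`: the cell
`(10, d)` at level `7` in the case «a rank-`8` set with `n − 3` points exists», for EVERY corank `d`. Nothing else is
claimed; no cell is closed here by itself (the complementary case is the LP cell with the rank-`8` flat bound `n − 4`).

* `union_inter_eq_of_subset`, `sdiff_union_eq_of_subset`, `glue_injOn`, `glue_disjoint_of_ne`, `ncard_glue_eq`, `ncard_glue_le`,
  **`s7lp_10_of_maxflat8`** (the reduction), **`s7lp_10_of_maxflat8'`** (the `(8, 6)` hypothesis discharged by the level-6 row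
  `ThmN.c025_six_all`, RankLevelSetLevelSixRowsNineToFifteen).
Axioms: standard.
-/

open scoped Matroid

namespace PercRepro

namespace S4Ups

open Set Finset S2LP S3LP S3MF

variable {α : Type} {M : Matroid α} [M.Finite]

omit [M.Finite] in
/-- A subset of `E` is the union of its traces on `F` and on `E ∖ F`. -/
theorem union_inter_eq_of_subset {F S : Set α} (hS : S ⊆ M.E) : (S ∩ F) ∪ (S ∩ (M.E \ F)) = S := by
  ext z
  simp only [mem_union, mem_inter_iff, mem_sdiff]
  constructor
  · rintro (⟨hz, -⟩ | ⟨hz, -⟩) <;> exact hz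
  · intro hz
    by_cases hzF : z ∈ F
    · exact Or.inl ⟨hz, hzF⟩
    · exact Or.inr ⟨hz, hS hz, hzF⟩

omit [M.Finite] in
/-- The complement of `A ∪ T` (`A ⊆ F`, `T ⊆ E ∖ F`) is `(F ∖ A) ∪ ((E ∖ F) ∖ T)`. -/
theorem sdiff_union_eq_of_subset {F A T : Set α} (hF : F ⊆ M.E) (hA : A ⊆ F) (hT : T ⊆ M.E \ F) :
    M.E \ (A ∪ T) = (F \ A) ∪ ((M.E \ F) \ T) := by
  ext z
  simp only [mem_sdiff, mem_union, not_or]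
  constructor
  · rintro ⟨hz, hzA, hzT⟩
    by_cases hzF : z ∈ F
    · exact Or.inl ⟨hzF, hzA⟩
    · exact Or.inr ⟨⟨hz, hzF⟩, hzT⟩
  · rintro (⟨hzF, hzA⟩ | ⟨⟨hz, hzF⟩, hzT⟩)
    · exact ⟨hF hzF, hzA, fun h => (hT h).2 hzF⟩
    · exact ⟨hz, fun h => hzF (hA h), hzT⟩

omit [M.Finite] in
/-- The union map is injective on pairs `(A, T)` with `A ⊆ F`, `T ⊆ E ∖ F`. -/
theorem glue_injOn {F : Set α} (G : Set (Set α)) (hG : ∀ A ∈ G, A ⊆ F) (H : Set (Set α)) (hH : ∀ T ∈ H, T ⊆ M.E \ F) :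
    InjOn (fun P : Set α × Set α => P.1 ∪ P.2) (G ×ˢ H) := by
  rintro ⟨A, T⟩ ⟨hA, hT⟩ ⟨A', T'⟩ ⟨hA', hT'⟩ h
  simp only at h hA hT hA' hT'
  have e1 := union_inter_left (M := M) (hG A hA) (hH T hT)
  have e2 := union_inter_left (M := M) (hG A' hA') (hH T' hT')
  have e3 := union_inter_right (M := M) (hG A hA) (hH T hT)
  have e4 := union_inter_right (M := M) (hG A' hA') (hH T' hT')
  rw [h] at e1 e3
  exact Prod.ext (e1.symm.trans e2) (e3.symm.trans e4)

omit [M.Finite] in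
/-- Glued families with different `(rank of A, size of T)` signatures are disjoint. -/
theorem glue_disjoint_of_ne {F : Set α} {r r' j j' : ℕ} (h : r ≠ r' ∨ j ≠ j') :
    Disjoint ((fun P : Set α × Set α => P.1 ∪ P.2) ''
        ({A : Set α | A ⊆ F ∧ M.eRk A = (r : ℕ∞)} ×ˢ {T : Set α | T ⊆ M.E \ F ∧ T.ncard = j}))
      ((fun P : Set α × Set α => P.1 ∪ P.2) ''
        ({A : Set α | A ⊆ F ∧ M.eRk A = (r' : ℕ∞)} ×ˢ {T : Set α | T ⊆ M.E \ F ∧ T.ncard = j'})) := by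
  rw [Set.disjoint_left]
  rintro S ⟨⟨A, T⟩, ⟨hA, hT⟩, rfl⟩ ⟨⟨A', T'⟩, ⟨hA', hT'⟩, hS⟩
  simp only [mem_setOf_eq] at hA hT hA' hT' hS
  have e1 := union_inter_left (M := M) hA.1 hT.1
  have e2 := union_inter_left (M := M) hA'.1 hT'.1
  have e3 := union_inter_right (M := M) hA.1 hT.1
  have e4 := union_inter_right (M := M) hA'.1 hT'.1
  rw [hS] at e2 e4
  have eA : A = A' := e1.symm.trans e2
  have eT : T = T' := e3.symm.trans e4
  rcases h with h | h
  · apply h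
    have := hA.2.symm.trans (eA ▸ hA'.2)
    exact_mod_cast this
  · apply h
    rw [← hT.2, ← hT'.2, eT]

/-- The number of glued sets `A ∪ T` with `A ∈ G`, `T ⊆ X = E ∖ F` of size `j`: `#G · C(|X|, j)`. -/
theorem ncard_glue_eq {F : Set α} (G : Set (Set α)) (hG : ∀ A ∈ G, A ⊆ F) (j : ℕ) :
    ((fun P : Set α × Set α => P.1 ∪ P.2) '' (G ×ˢ {T : Set α | T ⊆ M.E \ F ∧ T.ncard = j})).ncard =
      G.ncard * Nat.choose (M.E \ F).ncard j := by
  have hXfin : (M.E \ F).Finite := M.ground_finite.subset sdiff_subset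
  rw [InjOn.ncard_image (glue_injOn (M := M) G hG _ (fun T hT => hT.1)), ncard_prod,
    S1.ncard_setOf_subset_ncard_eq hXfin j]

/-- The number of glued sets is at most `#G · C(|X|, j)` (no injectivity needed). -/
theorem ncard_glue_le {F : Set α} (G : Set (Set α)) (hG : ∀ A ∈ G, A ⊆ F) (j : ℕ) :
    ((fun P : Set α × Set α => P.1 ∪ P.2) '' (G ×ˢ {T : Set α | T ⊆ M.E \ F ∧ T.ncard = j})).ncard ≤
      G.ncard * Nat.choose (M.E \ F).ncard j :=
  (ncard_glue_eq G hG j).le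

section Reduction

variable (hM : M.eRank = ((10 : ℕ) : ℕ∞)) (hcol : M.coloops = ∅) {F : Set α} (hF : F ⊆ M.E)
  (hFr : M.eRk F = ((8 : ℕ) : ℕ∞)) (hFn : F.ncard + 3 = M.E.ncard)
include hM hcol hF hFr hFn

set_option maxHeartbeats 4000000 in
/-- **THE ROW `p = 10` OF LEVEL `7` WITH A MAXIMAL RANK-`8` FLAT**: if `F ⊆ E` has rank `8` and `|E ∖ F| = 3` in a coloop-free
matroid of rank `10`, then `5/2 · #U(10, 7) ≤ #Y(10, 7)` follows from C-025 at `(8, 6)` on `M ↾ F`. -/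
theorem s7lp_10_of_maxflat8 [(M ↾ F).Finite] (hrls : ThmN.RLS (M ↾ F) 8 6) :
    (5 / 2 : ℚ) * (Matroid.topCount M 10 7 : ℚ) ≤ (Matroid.midCount M 10 7 : ℚ) := by
  have hFn' : F.ncard + (10 - 8 + 1) = M.E.ncard := by norm_num; exact hFn
  have hX3 : (M.E \ F).ncard = 3 := by
    have h := ncard_sdiff_add_ncard_of_subset hF M.ground_finite
    omega
  have hXfin : (M.E \ F).Finite := M.ground_finite.subset sdiff_subset
  have hFfin : F.Finite := M.ground_finite.subset hF
  have hPfin : {A : Set α | A ⊆ F}.Finite := hFfin.finite_subsets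
  -- rank additivity for `A ⊆ F`, `T ⊊ X`
  have radd : ∀ {A T : Set α}, A ⊆ F → T ⊆ M.E \ F → T ≠ M.E \ F → ∀ {r : ℕ}, M.eRk A = (r : ℕ∞) →
      M.eRk (A ∪ T) = ((r + T.ncard : ℕ) : ℕ∞) :=
    fun {_ _} hA hT hTne {_} hAr => eRk_union_eq_add hM hcol hF hFr (by norm_num) hFn' hA hT hTne hAr
  have hne_of_lt : ∀ {T : Set α}, T ⊆ M.E \ F → T.ncard < 3 → T ≠ M.E \ F := by
    intro T _ hT3 hTX
    rw [hTX, hX3] at hT3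
    omega
  -- the rank of a subset of `F` is at most `8`, and finite
  have hrkF : ∀ {A : Set α}, A ⊆ F → ∃ r : ℕ, M.eRk A = (r : ℕ∞) ∧ r ≤ 8 := by
    intro A hA
    have hle : M.eRk A ≤ ((8 : ℕ) : ℕ∞) := by rw [← hFr]; exact M.eRk_mono hA
    have hfin : M.eRk A ≠ ⊤ := ne_top_of_le_ne_top (ENat.coe_ne_top 8) hle
    obtain ⟨r, hr⟩ := ENat.ne_top_iff_exists.mp hfin
    refine ⟨r, hr.symm, ?_⟩
    rw [← hr] at hle
    exact_mod_cast hle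
  -- the families
  set W8 := {A : Set α | A ⊆ F ∧ M.eRk A = ((8 : ℕ) : ℕ∞)} with hW8
  set W7 := {A : Set α | A ⊆ F ∧ M.eRk A = ((7 : ℕ) : ℕ∞)} with hW7
  set UF := {A : Set α | A ⊆ F ∧ M.eRk A = ((8 : ℕ) : ℕ∞) ∧ M.eRk (F \ A) = ((6 : ℕ) : ℕ∞)} with hUF
  set V8 := {A : Set α | A ⊆ F ∧ M.eRk A = ((8 : ℕ) : ℕ∞) ∧ M.eRk (F \ A) = ((7 : ℕ) : ℕ∞)} with hV8
  set V7 := {A : Set α | A ⊆ F ∧ M.eRk A = ((7 : ℕ) : ℕ∞) ∧ M.eRk (F \ A) = ((7 : ℕ) : ℕ∞)} with hV7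
  have hW8fin : W8.Finite := hPfin.subset (fun _ h => h.1)
  have hW7fin : W7.Finite := hPfin.subset (fun _ h => h.1)
  have hUFfin : UF.Finite := hPfin.subset (fun _ h => h.1)
  have hV8fin : V8.Finite := hPfin.subset (fun _ h => h.1)
  have hV7fin : V7.Finite := hPfin.subset (fun _ h => h.1)
  -- (1) the `U`-side: `#U ≤ 3 #UF + #V8 + #V7`
  have hU : Matroid.topCount M 10 7 ≤ 3 * UF.ncard + V8.ncard + V7.ncard := by
    unfold Matroid.topCount
    obtain ⟨I1, hI1⟩ : ∃ I : Set (Set α), I = (fun P : Set α × Set α => P.1 ∪ P.2) ''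
      (UF ×ˢ {T : Set α | T ⊆ M.E \ F ∧ T.ncard = 2}) := ⟨_, rfl⟩
    obtain ⟨I2, hI2⟩ : ∃ I : Set (Set α), I = (fun P : Set α × Set α => P.1 ∪ P.2) ''
      (V8 ×ˢ {T : Set α | T ⊆ M.E \ F ∧ T.ncard = 3}) := ⟨_, rfl⟩
    obtain ⟨I3, hI3⟩ : ∃ I : Set (Set α), I = (fun P : Set α × Set α => P.1 ∪ P.2) ''
      (V7 ×ˢ {T : Set α | T ⊆ M.E \ F ∧ T.ncard = 3}) := ⟨_, rfl⟩
    have hsub : {A : Set α | A ⊆ M.E ∧ M.eRk A = ((10 : ℕ) : ℕ∞) ∧ M.eRk (M.E \ A) = ((7 : ℕ) : ℕ∞)} ⊆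
        I1 ∪ (I2 ∪ I3) := by
      rw [hI1, hI2, hI3]
      rintro S ⟨hSE, hS10, hS7⟩
      have hdec := union_inter_eq_of_subset (M := M) (F := F) hSE
      have hAF : S ∩ F ⊆ F := inter_subset_right
      have hTX : S ∩ (M.E \ F) ⊆ M.E \ F := inter_subset_right
      obtain ⟨r, hr, hr8⟩ := hrkF hAF
      have hT3 : (S ∩ (M.E \ F)).ncard ≤ 3 := by rw [← hX3]; exact ncard_le_ncard hTX hXfin
      rcases Nat.lt_or_ge (S ∩ (M.E \ F)).ncard 3 with hlt | hge
      · -- `T ⊊ X`: rank additivity on `S` and on `E ∖ S`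
        have hTne := hne_of_lt hTX hlt
        have h1 := radd hAF hTX hTne hr
        rw [hdec, hS10] at h1
        have h1' : 10 = r + (S ∩ (M.E \ F)).ncard := by exact_mod_cast h1
        have hr8' : r = 8 := by omega
        have hT2 : (S ∩ (M.E \ F)).ncard = 2 := by omega
        -- the complement
        have hcomp : M.E \ S = (F \ (S ∩ F)) ∪ ((M.E \ F) \ (S ∩ (M.E \ F))) := by
          conv_lhs => rw [← hdec]
          exact sdiff_union_eq_of_subset hF hAF hTX
        have hT'X : (M.E \ F) \ (S ∩ (M.E \ F)) ⊆ M.E \ F := sdiff_subset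
        have hT'1 : ((M.E \ F) \ (S ∩ (M.E \ F))).ncard = 1 := by
          rw [ncard_sdiff' hTX hXfin, hX3, hT2]
        have hT'ne := hne_of_lt hT'X (by omega)
        obtain ⟨r', hr', -⟩ := hrkF (sdiff_subset : F \ (S ∩ F) ⊆ F)
        have h2 := radd (sdiff_subset : F \ (S ∩ F) ⊆ F) hT'X hT'ne hr'
        rw [← hcomp, hS7, hT'1] at h2
        have h2' : 7 = r' + 1 := by exact_mod_cast h2
        left
        refine ⟨⟨S ∩ F, S ∩ (M.E \ F)⟩, ⟨⟨hAF, ?_, ?_⟩, hTX, hT2⟩, hdec⟩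
        · rw [hr, hr8']
        · rw [hr']; congr 1; omega
      · -- `T = X`: the complement is `F ∖ A`
        have hTX' : S ∩ (M.E \ F) = M.E \ F := eq_of_subset_of_ncard_le hTX (by omega) hXfin
        have hcomp : M.E \ S = F \ (S ∩ F) := by
          conv_lhs => rw [← hdec]
          rw [sdiff_union_eq_of_subset hF hAF hTX, hTX', Set.sdiff_self, union_empty]
        rw [hcomp] at hS7
        -- `ρ(A) ≥ 7` from `10 = ρ(A ∪ X) ≤ ρ(A) + |X|`
        have hup : M.eRk S ≤ M.eRk (S ∩ F) + M.eRk (S ∩ (M.E \ F)) := by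
          conv_lhs => rw [← hdec]
          exact M.eRk_union_le_eRk_add_eRk _ _
        have hXr : M.eRk (S ∩ (M.E \ F)) ≤ ((3 : ℕ) : ℕ∞) := by
          rw [hTX']
          calc M.eRk (M.E \ F) ≤ (M.E \ F).encard := M.eRk_le_encard _
            _ = ((3 : ℕ) : ℕ∞) := by rw [← hXfin.cast_ncard_eq, hX3]
        rw [hS10, hr] at hup
        have hup' : M.eRk S ≤ ((r + 3 : ℕ) : ℕ∞) := by
          rw [hS10]
          calc ((10 : ℕ) : ℕ∞) ≤ (r : ℕ∞) + M.eRk (S ∩ (M.E \ F)) := hup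
            _ ≤ (r : ℕ∞) + ((3 : ℕ) : ℕ∞) := add_le_add le_rfl hXr
            _ = ((r + 3 : ℕ) : ℕ∞) := by push_cast; rfl
        rw [hS10] at hup'
        have hr7 : 7 ≤ r := by
          have : (10 : ℕ) ≤ r + 3 := by exact_mod_cast hup'
          omega
        right
        rcases Nat.eq_or_lt_of_le hr7 with h7 | h8
        · right
          refine ⟨⟨S ∩ F, S ∩ (M.E \ F)⟩, ⟨⟨hAF, ?_, hS7⟩, hTX, le_antisymm hT3 hge⟩, hdec⟩
          rw [hr, ← h7]
        · left
          refine ⟨⟨S ∩ F, S ∩ (M.E \ F)⟩, ⟨⟨hAF, ?_, hS7⟩, hTX, le_antisymm hT3 hge⟩, hdec⟩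
          rw [hr]; congr 1; omega
    have hfin1 : I1.Finite := by
      rw [hI1]; exact (hUFfin.prod (hXfin.finite_subsets.subset (fun _ h => h.1))).image _
    have hfin2 : I2.Finite := by
      rw [hI2]; exact (hV8fin.prod (hXfin.finite_subsets.subset (fun _ h => h.1))).image _
    have hfin3 : I3.Finite := by
      rw [hI3]; exact (hV7fin.prod (hXfin.finite_subsets.subset (fun _ h => h.1))).image _
    have hc1 : I1.ncard ≤ UF.ncard * Nat.choose (M.E \ F).ncard 2 := by
      rw [hI1]; exact ncard_glue_le UF (fun _ h => h.1) 2
    have hc2 : I2.ncard ≤ V8.ncard * Nat.choose (M.E \ F).ncard 3 := by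
      rw [hI2]; exact ncard_glue_le V8 (fun _ h => h.1) 3
    have hc3 : I3.ncard ≤ V7.ncard * Nat.choose (M.E \ F).ncard 3 := by
      rw [hI3]; exact ncard_glue_le V7 (fun _ h => h.1) 3
    rw [hX3, show Nat.choose 3 2 = 3 by decide] at hc1
    rw [hX3, show Nat.choose 3 3 = 1 by decide] at hc2 hc3
    have h1 := ncard_le_ncard hsub (hfin1.union (hfin2.union hfin3))
    have h2 := ncard_union_le I1 (I2 ∪ I3)
    have h3 := ncard_union_le I2 I3
    omega
  -- (2) the `Y`-side: `#Y ≥ 4 #W8 + 6 #W7`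
  have hY : 4 * W8.ncard + 6 * W7.ncard ≤ Matroid.midCount M 10 7 := by
    unfold Matroid.midCount
    -- the four glued families, all inside `Y`
    have hglueY : ∀ (r j : ℕ), 7 < r + j → r + j < 10 → j < 3 →
        (fun P : Set α × Set α => P.1 ∪ P.2) ''
            ({A : Set α | A ⊆ F ∧ M.eRk A = (r : ℕ∞)} ×ˢ {T : Set α | T ⊆ M.E \ F ∧ T.ncard = j}) ⊆
          {A : Set α | A ⊆ M.E ∧ ((7 : ℕ) : ℕ∞) < M.eRk A ∧ M.eRk A < ((10 : ℕ) : ℕ∞)} := by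
      intro r j h1 h2 hj
      rintro S ⟨⟨A, T⟩, ⟨hA, hT⟩, rfl⟩
      simp only [mem_setOf_eq] at hA hT
      have hTne : T ≠ M.E \ F := hne_of_lt hT.1 (by omega)
      have hrk := radd hA.1 hT.1 hTne hA.2
      simp only
      refine ⟨union_subset (hA.1.trans hF) (hT.1.trans sdiff_subset), ?_, ?_⟩
      · rw [hrk, hT.2]; exact_mod_cast h1
      · rw [hrk, hT.2]; exact_mod_cast h2
    obtain ⟨G80, hG80⟩ : ∃ G : Set (Set α), G = (fun P : Set α × Set α => P.1 ∪ P.2) ''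
      (W8 ×ˢ {T : Set α | T ⊆ M.E \ F ∧ T.ncard = 0}) := ⟨_, rfl⟩
    obtain ⟨G71, hG71⟩ : ∃ G : Set (Set α), G = (fun P : Set α × Set α => P.1 ∪ P.2) ''
      (W7 ×ˢ {T : Set α | T ⊆ M.E \ F ∧ T.ncard = 1}) := ⟨_, rfl⟩
    obtain ⟨G81, hG81⟩ : ∃ G : Set (Set α), G = (fun P : Set α × Set α => P.1 ∪ P.2) ''
      (W8 ×ˢ {T : Set α | T ⊆ M.E \ F ∧ T.ncard = 1}) := ⟨_, rfl⟩
    obtain ⟨G72, hG72⟩ : ∃ G : Set (Set α), G = (fun P : Set α × Set α => P.1 ∪ P.2) ''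
      (W7 ×ˢ {T : Set α | T ⊆ M.E \ F ∧ T.ncard = 2}) := ⟨_, rfl⟩
    have hsub : G80 ∪ G71 ∪ G81 ∪ G72 ⊆
        {A : Set α | A ⊆ M.E ∧ ((7 : ℕ) : ℕ∞) < M.eRk A ∧ M.eRk A < ((10 : ℕ) : ℕ∞)} := by
      rw [hG80, hG71, hG81, hG72]
      refine union_subset (union_subset (union_subset ?_ ?_) ?_) ?_
      · exact hglueY 8 0 (by norm_num) (by norm_num) (by norm_num)
      · exact hglueY 7 1 (by norm_num) (by norm_num) (by norm_num)
      · exact hglueY 8 1 (by norm_num) (by norm_num) (by norm_num)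
      · exact hglueY 7 2 (by norm_num) (by norm_num) (by norm_num)
    have hYfin : {A : Set α | A ⊆ M.E ∧ ((7 : ℕ) : ℕ∞) < M.eRk A ∧ M.eRk A < ((10 : ℕ) : ℕ∞)}.Finite :=
      M.ground_finite.finite_subsets.subset (fun _ h => h.1)
    have hd1 : Disjoint G80 G71 := by
      rw [hG80, hG71]; exact glue_disjoint_of_ne (M := M) (Or.inr (by norm_num))
    have hd2 : Disjoint (G80 ∪ G71) G81 := by
      rw [hG80, hG71, hG81, Set.disjoint_union_left]
      exact ⟨glue_disjoint_of_ne (M := M) (Or.inr (by norm_num)), glue_disjoint_of_ne (M := M) (Or.inl (by norm_num))⟩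
    have hd3 : Disjoint (G80 ∪ G71 ∪ G81) G72 := by
      rw [hG80, hG71, hG81, hG72, Set.disjoint_union_left, Set.disjoint_union_left]
      exact ⟨⟨glue_disjoint_of_ne (M := M) (Or.inr (by norm_num)), glue_disjoint_of_ne (M := M) (Or.inr (by norm_num))⟩,
        glue_disjoint_of_ne (M := M) (Or.inr (by norm_num))⟩
    have hfinU : (G80 ∪ G71 ∪ G81 ∪ G72).Finite := hYfin.subset hsub
    have hfinA : (G80 ∪ G71 ∪ G81).Finite := hfinU.subset subset_union_left
    have hfinB : (G80 ∪ G71).Finite := hfinA.subset subset_union_left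
    have hcount : (G80 ∪ G71 ∪ G81 ∪ G72).ncard = 4 * W8.ncard + 6 * W7.ncard := by
      rw [ncard_union_eq hd3 hfinA (hfinU.subset subset_union_right),
        ncard_union_eq hd2 hfinB (hfinA.subset subset_union_right),
        ncard_union_eq hd1 (hfinB.subset subset_union_left) (hfinB.subset subset_union_right),
        hG80, hG71, hG81, hG72, ncard_glue_eq W8 (fun _ h => h.1) 0, ncard_glue_eq W7 (fun _ h => h.1) 1,
        ncard_glue_eq W8 (fun _ h => h.1) 1, ncard_glue_eq W7 (fun _ h => h.1) 2, hX3,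
        show Nat.choose 3 0 = 1 by decide, show Nat.choose 3 1 = 3 by decide, show Nat.choose 3 2 = 3 by decide]
      ring
    rw [← hcount]
    exact ncard_le_ncard hsub hYfin
  -- (3) `#UF + #V8 ≤ #W8`, `#V7 ≤ #W7`
  have hUV : UF.ncard + V8.ncard ≤ W8.ncard := by
    have hdisj : Disjoint UF V8 := by
      rw [Set.disjoint_left]
      rintro A ⟨-, -, h6⟩ ⟨-, -, h7⟩
      rw [h6] at h7
      have : (6 : ℕ) = 7 := by exact_mod_cast h7
      omega
    rw [← ncard_union_eq hdisj hUFfin hV8fin]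
    exact ncard_le_ncard (union_subset (fun _ h => ⟨h.1, h.2.1⟩) (fun _ h => ⟨h.1, h.2.1⟩)) hW8fin
  have hV7W : V7.ncard ≤ W7.ncard := ncard_le_ncard (fun _ h => ⟨h.1, h.2.1⟩) hW7fin
  -- (4) C-025 at `(8, 6)` on `M ↾ F`: `8/7 · #UF ≤ #W7`
  have hrls' : (8 / 7 : ℚ) * (UF.ncard : ℚ) ≤ (W7.ncard : ℚ) := by
    unfold ThmN.RLS at hrls
    rw [phiK_eight_six] at hrls
    have e1 : {A : Set α | A ⊆ (M ↾ F).E ∧ (M ↾ F).eRk A = ((8 : ℕ) : ℕ∞) ∧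
        (M ↾ F).eRk ((M ↾ F).E \ A) = ((6 : ℕ) : ℕ∞)} = UF := by
      ext A
      simp only [hUF, mem_setOf_eq, Matroid.restrict_ground_eq]
      constructor
      · rintro ⟨h1, h2, h3⟩
        rw [M.restrict_eRk_eq h1] at h2
        rw [M.restrict_eRk_eq sdiff_subset] at h3
        exact ⟨h1, h2, h3⟩
      · rintro ⟨h1, h2, h3⟩
        exact ⟨h1, by rwa [M.restrict_eRk_eq h1], by rwa [M.restrict_eRk_eq sdiff_subset]⟩
    have e2 : {A : Set α | A ⊆ (M ↾ F).E ∧ ((6 : ℕ) : ℕ∞) < (M ↾ F).eRk A ∧ (M ↾ F).eRk A < ((8 : ℕ) : ℕ∞)} = W7 := by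
      ext A
      simp only [hW7, mem_setOf_eq, Matroid.restrict_ground_eq]
      constructor
      · rintro ⟨h1, h2, h3⟩
        refine ⟨h1, ?_⟩
        rw [M.restrict_eRk_eq h1] at h2 h3
        obtain ⟨r, hr, -⟩ := hrkF h1
        rw [hr] at h2 h3 ⊢
        have h2' : 6 < r := by exact_mod_cast h2
        have h3' : r < 8 := by exact_mod_cast h3
        exact_mod_cast (show r = 7 by omega)
      · rintro ⟨h1, h2⟩
        refine ⟨h1, ?_, ?_⟩
        · rw [M.restrict_eRk_eq h1, h2]; exact_mod_cast (by norm_num : (6 : ℕ) < 7)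
        · rw [M.restrict_eRk_eq h1, h2]; exact_mod_cast (by norm_num : (7 : ℕ) < 8)
    rw [e1, e2] at hrls
    exact hrls
  -- (5) the arithmetic
  have hUq : (Matroid.topCount M 10 7 : ℚ) ≤ 3 * (UF.ncard : ℚ) + (V8.ncard : ℚ) + (V7.ncard : ℚ) := by
    exact_mod_cast hU
  have hYq : 4 * (W8.ncard : ℚ) + 6 * (W7.ncard : ℚ) ≤ (Matroid.midCount M 10 7 : ℚ) := by
    exact_mod_cast hY
  have hUVq : (UF.ncard : ℚ) + (V8.ncard : ℚ) ≤ (W8.ncard : ℚ) := by exact_mod_cast hUV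
  have hV7Wq : (V7.ncard : ℚ) ≤ (W7.ncard : ℚ) := by exact_mod_cast hV7W
  have hV8nn : (0 : ℚ) ≤ (V8.ncard : ℚ) := by positivity
  linarith

/-- **THE SAME, UNCONDITIONAL**: the `(8, 6)` hypothesis is the level-6 row `c025_six_all` on `M ↾ F`. -/
theorem s7lp_10_of_maxflat8' : (5 / 2 : ℚ) * (Matroid.topCount M 10 7 : ℚ) ≤ (Matroid.midCount M 10 7 : ℚ) := by
  haveI : (M ↾ F).Finite := Matroid.restrict_finite (M.ground_finite.subset hF)
  exact s7lp_10_of_maxflat8 hM hcol hF hFr hFn (ThmN.c025_six_all (M ↾ F) 8 le_rfl)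

end Reduction

end S4Ups

end PercRepro
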